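import Literature.NumberTheory.LFunctions.FeketePolyaKernelCertificatesBlockWrappers
import HarnessLib

/-!
# No real zero for real primitive characters of conductor `19567 ≤ q ≤ 20000`: the Fekete–Pólya rows, in the kernel (rows deferred by the earlier engines)

Topic `Literature/NumberTheory/LFunctions`; namespace `Literature.NumberTheory.LFunctions`. THEOREMS only (no
definition, no named fact, no `sorry`; standard axioms): one PUBLIC theorem **`noRealZero{Odd,Even}_fp_<q>`** per
fundamental discriminant `D`, `|D| = q ∈ [19567, 20000]`, that admits a Fekete–Pólya witness but was DEFERRED by the per-position engines v1/v2 (walk too long for one `decide`) — for every primitive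
quadratic `χ` mod `q` of the parity of `D` and every `σ ∈ (0, 1)`, `L(σ, χ) ≠ 0` (statement shape of the
`interval_cases` bullets of the `NoRealZero{Odd,Even}…` range files, so a range assembly cites them by name).
Cell `parity-realchar`, kernel floor of the wide column (TARGET §2 row 19), Fekete–Pólya lane (seat prover-2).

Method (engine v4): `FeketePolyaKernelCertificatesBlock{,Wrappers}.lean` — the iterated partial sums of order
`K` of the induced character `χ↑(q·w)` are non-negative over one period, decided in the kernel BLOCKWISE on packed
base-`2^b` digits (`blockCert b B K (q·w) (tabs… b ps q w)`: sign tables of the character from the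
quadratic-residue bitsets of the prime factors of the conductor — the factor list is part of each certificate,
primality by `norm_num` — prefix sums by one big-integer multiplication per order and block, sign test by one
AND), hence `ℜL(σ, χ↑(q·w)) > 0` (Fekete–Pólya 1912 / MV §11.2.1 Exercise 7) and `L(σ, χ) ≠ 0` (positive Euler
factors, Exercise 8).  Witnesses `(w, K)` = the cheapest in the exact integer scan of this seat
(`HOME/parity-realchar-prover-2/fp-witnesses-*.tsv`; no kit); the digit width `b` is two bits above the size of
the running-sum bound recorded by the scan.  10 characters in this file (est. 51 kernel-s).
NOT covered here (no Fekete–Pólya witness with `w ≤ 40`, `q·w ≤ 4·10⁵`, `K ≤ 12`; the other Fekete–Pólya rows of this range are in the `NoRealZeroFeketePolyaX…` files) — left to the truncation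
certificates of the companion lane: see those files.

## References

* H. L. Montgomery, R. C. Vaughan, *Multiplicative Number Theory I*, CUP 2007, §9.3 Thm 9.13, §11.2.1
  Exercises 7–8. [MontgomeryVaughan2007]
* M. Fekete, G. Pólya, *Über ein Problem von Laguerre*, Rend. Circ. Mat. Palermo 34 (1912) 89–120. [FeketePolya1912]
-/

namespace Literature.NumberTheory.LFunctions

open FeketePolyaKernel

set_option maxHeartbeats 400000 in
/-- `D = -19567`: the odd character `(·/19567)` of conductor `19567` (`19567`: 17 · 1151) — Fekete–Pólya witness of order `8` along the induced modulus `19567·5 = 97835`, block certificate (digits of `112` bits, splitting depth `9`); est. `4.3` kernel-s. [cite: MontgomeryVaughan2007, §11.2.1 Exercises 7 (g), 8] -/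
theorem noRealZeroOdd_fp_19567 :
    ∀ χ : DirichletCharacter ℂ 19567, χ.IsQuadratic → χ.IsPrimitive → χ.Odd →
      ∀ σ : ℝ, 0 < σ → σ < 1 → χ.LFunction σ ≠ 0 :=
  good_odd_of_odd_blk [17, 1151] (by norm_num) (by decide) (by decide) 5 8 112 9 (by decide) (by decide) (by decide)
    (Or.inr (by decide +kernel))

set_option maxHeartbeats 400000 in
/-- `D = -19695`: the odd character `(·/19695)` of conductor `19695` (`19695`: 3 · 5 · 13 · 101) — Fekete–Pólya witness of order `7` along the induced modulus `19695·7 = 137865`, block certificate (digits of `102` bits, splitting depth `10`); est. `5.0` kernel-s. [cite: MontgomeryVaughan2007, §11.2.1 Exercises 7 (g), 8] -/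
theorem noRealZeroOdd_fp_19695 :
    ∀ χ : DirichletCharacter ℂ 19695, χ.IsQuadratic → χ.IsPrimitive → χ.Odd →
      ∀ σ : ℝ, 0 < σ → σ < 1 → χ.LFunction σ ≠ 0 :=
  good_odd_of_odd_blk [3, 5, 13, 101] (by norm_num) (by decide) (by decide) 7 7 102 10 (by decide) (by decide) (by decide)
    (Or.inr (by decide +kernel))

set_option maxHeartbeats 400000 in
/-- `D = -19699`: the odd character `(·/19699)` of conductor `19699` (`19699`: prime) — Fekete–Pólya witness of order `6` along the induced modulus `19699·14 = 275786`, block certificate (digits of `92` bits, splitting depth `11`); est. `9.3` kernel-s. [cite: MontgomeryVaughan2007, §11.2.1 Exercises 7 (g), 8] -/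
theorem noRealZeroOdd_fp_19699 :
    ∀ χ : DirichletCharacter ℂ 19699, χ.IsQuadratic → χ.IsPrimitive → χ.Odd →
      ∀ σ : ℝ, 0 < σ → σ < 1 → χ.LFunction σ ≠ 0 :=
  good_odd_of_odd_blk [19699] (by norm_num) (by decide) (by decide) 14 6 92 11 (by decide) (by decide) (by decide)
    (Or.inr (by decide +kernel))

set_option maxHeartbeats 400000 in
/-- `D = -19707`: the odd character `(·/19707)` of conductor `19707` (`19707`: 3 · 6569) — Fekete–Pólya witness of order `5` along the induced modulus `19707·10 = 197070`, block certificate (digits of `75` bits, splitting depth `10`); est. `5.1` kernel-s. [cite: MontgomeryVaughan2007, §11.2.1 Exercises 7 (g), 8] -/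
theorem noRealZeroOdd_fp_19707 :
    ∀ χ : DirichletCharacter ℂ 19707, χ.IsQuadratic → χ.IsPrimitive → χ.Odd →
      ∀ σ : ℝ, 0 < σ → σ < 1 → χ.LFunction σ ≠ 0 :=
  good_odd_of_odd_blk [3, 6569] (by norm_num) (by decide) (by decide) 10 5 75 10 (by decide) (by decide) (by decide)
    (Or.inr (by decide +kernel))

set_option maxHeartbeats 400000 in
/-- `D = -19715`: the odd character `(·/19715)` of conductor `19715` (`19715`: 5 · 3943) — Fekete–Pólya witness of order `4` along the induced modulus `19715·11 = 216865`, block certificate (digits of `59` bits, splitting depth `9`); est. `3.1` kernel-s. [cite: MontgomeryVaughan2007, §11.2.1 Exercises 7 (g), 8] -/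
theorem noRealZeroOdd_fp_19715 :
    ∀ χ : DirichletCharacter ℂ 19715, χ.IsQuadratic → χ.IsPrimitive → χ.Odd →
      ∀ σ : ℝ, 0 < σ → σ < 1 → χ.LFunction σ ≠ 0 :=
  good_odd_of_odd_blk [5, 3943] (by norm_num) (by decide) (by decide) 11 4 59 9 (by decide) (by decide) (by decide)
    (Or.inr (by decide +kernel))

set_option maxHeartbeats 400000 in
/-- `D = 19768`: the even character `χ₋₈·(·/2471)` of conductor `19768` (`2471`: 7 · 353) — Fekete–Pólya witness of order `3` along the induced modulus `19768·13 = 256984`, block certificate (digits of `41` bits, splitting depth `9`); est. `2.4` kernel-s. [cite: MontgomeryVaughan2007, §11.2.1 Exercises 7 (g), 8] -/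
theorem noRealZeroEven_fp_19768 :
    ∀ χ : DirichletCharacter ℂ 19768, χ.IsQuadratic → χ.IsPrimitive → χ.Even →
      ∀ σ : ℝ, 0 < σ → σ < 1 → χ.LFunction σ ≠ 0 :=
  good_even_of_eight_blk [7, 353] (by norm_num) (by decide) (by decide) 13 3 41 9 (by decide) (by decide) (by decide)
    (Or.inr (by decide +kernel)) (Or.inl (by decide +kernel))

set_option maxHeartbeats 400000 in
/-- `D = 19853`: the even character `(·/19853)` of conductor `19853` (`19853`: prime) — Fekete–Pólya witness of order `5` along the induced modulus `19853·10 = 198530`, block certificate (digits of `73` bits, splitting depth `10`); est. `5.9` kernel-s. [cite: MontgomeryVaughan2007, §11.2.1 Exercises 7 (g), 8] -/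
theorem noRealZeroEven_fp_19853 :
    ∀ χ : DirichletCharacter ℂ 19853, χ.IsQuadratic → χ.IsPrimitive → χ.Even →
      ∀ σ : ℝ, 0 < σ → σ < 1 → χ.LFunction σ ≠ 0 :=
  good_even_of_odd_blk [19853] (by norm_num) (by decide) (by decide) 10 5 73 10 (by decide) (by decide) (by decide)
    (Or.inr (by decide +kernel))

set_option maxHeartbeats 400000 in
/-- `D = -19859`: the odd character `(·/19859)` of conductor `19859` (`19859`: 7 · 2837) — Fekete–Pólya witness of order `7` along the induced modulus `19859·11 = 218449`, block certificate (digits of `105` bits, splitting depth `10`); est. `8.0` kernel-s. [cite: MontgomeryVaughan2007, §11.2.1 Exercises 7 (g), 8] -/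
theorem noRealZeroOdd_fp_19859 :
    ∀ χ : DirichletCharacter ℂ 19859, χ.IsQuadratic → χ.IsPrimitive → χ.Odd →
      ∀ σ : ℝ, 0 < σ → σ < 1 → χ.LFunction σ ≠ 0 :=
  good_odd_of_odd_blk [7, 2837] (by norm_num) (by decide) (by decide) 11 7 105 10 (by decide) (by decide) (by decide)
    (Or.inr (by decide +kernel))

set_option maxHeartbeats 400000 in
/-- `D = 19928`: the even character `χ₋₈·(·/2491)` of conductor `19928` (`2491`: 47 · 53) — Fekete–Pólya witness of order `7` along the induced modulus `19928·5 = 99640`, block certificate (digits of `97` bits, splitting depth `9`); est. `3.5` kernel-s. [cite: MontgomeryVaughan2007, §11.2.1 Exercises 7 (g), 8] -/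
theorem noRealZeroEven_fp_19928 :
    ∀ χ : DirichletCharacter ℂ 19928, χ.IsQuadratic → χ.IsPrimitive → χ.Even →
      ∀ σ : ℝ, 0 < σ → σ < 1 → χ.LFunction σ ≠ 0 :=
  good_even_of_eight_blk [47, 53] (by norm_num) (by decide) (by decide) 5 7 97 9 (by decide) (by decide) (by decide)
    (Or.inr (by decide +kernel)) (Or.inl (by decide +kernel))

set_option maxHeartbeats 400000 in
/-- `D = 19949`: the even character `(·/19949)` of conductor `19949` (`19949`: prime) — Fekete–Pólya witness of order `6` along the induced modulus `19949·6 = 119694`, block certificate (digits of `85` bits, splitting depth `9`); est. `4.7` kernel-s. [cite: MontgomeryVaughan2007, §11.2.1 Exercises 7 (g), 8] -/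
theorem noRealZeroEven_fp_19949 :
    ∀ χ : DirichletCharacter ℂ 19949, χ.IsQuadratic → χ.IsPrimitive → χ.Even →
      ∀ σ : ℝ, 0 < σ → σ < 1 → χ.LFunction σ ≠ 0 :=
  good_even_of_odd_blk [19949] (by norm_num) (by decide) (by decide) 6 6 85 9 (by decide) (by decide) (by decide)
    (Or.inr (by decide +kernel))

end Literature.NumberTheory.LFunctions
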